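import Mathlib
import Summits.ValiantsHypothesis.ValiantsHypothesis.Theorems.BinomialElusiveBinomialCandidateCrossCap
import Summits.ValiantsHypothesis.ValiantsHypothesis.Theorems.BinomialElusiveBinomialCandidateLowDegreeVanishingDeg
import Summits.ValiantsHypothesis.ValiantsHypothesis.Theorems.BinomialElusiveBinomialCandidateCorankOneNormalForm
import Summits.ValiantsHypothesis.ValiantsHypothesis.Theorems.BinomialElusiveBinomialCandidateCorankOneIteration
import Summits.ValiantsHypothesis.ValiantsHypothesis.Theorems.BinomialElusiveBinomialCandidateCorankOneEliminantMembership
import Summits.ValiantsHypothesis.ValiantsHypothesis.Theorems.BinomialElusiveBinomialCandidateCorankOneEliminantLeadingForm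

/-!
# Crux `BinomialElusive.BinomialCandidate` (stmt-ValiantsHypothesis-7392), line `registered` —
# stub `stub_shallowCorankOne`: shallow corank-one base points are impossible for E-type data

The registered stub `stub_shallowCorankOne` of skeleton v5 (lead c2): an integral formal solution
`p` of `Γ(p) = T`, `T_i = t^{N a_i} + t^{N b_i}`, whose base point `y₀ = p(0)` is a corank-one point
of `Γ` (Jacobian columns with a one-dimensional kernel `ℂκ`) and is NOT deep to order `D` — no
polynomial arc `γ` with `γ(0) = y₀`, `γ'(0) = κ` and `Γ_i(γ(x)) ≡ 0 (mod x^{D+1})` for all `i` —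
cannot exist when the exponents have (P1) no relation of length `≤ 2D` and (P2) a congruence
modulus with factor `D`.  This generalises `stub_crossCap` (depth `2`) to every depth `d ≤ D`.

Proof (assembly of the wave-2 pieces, following the cross-cap assembly with `2 → d`):
1. `corankOne_normalForm` — target coordinates `P`, source coordinates `S` (`S e_0 = κ`),
   polynomials `B_i` without monomials of degree `< 2`, series `q` of positive order in normal form
   (`T̂ = P T`), and the polynomial identity `Σ_{i'} P_{ii'} Γ_{i'}(y₀ + S Y) = [Y_{i-1}] + B_i(Y)`;
2. `corankOne_iteration` — `F₀, F₁ ∈ ℂ[W][X]` with `F_a(T̂, q_0) ≡ 0 (mod t^G)`, the kernel-curve jet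
   `φ` and `f_{a,j}(0) = [x^j] B_a(x, φ(x))` (`j ≤ D`), `λ_{W_b}(f_{a,0}) = -δ_{ab}`;
3. the depth `d ≤ D`: the least `j` with `(f_{0,j}(0), f_{1,j}(0)) ≠ 0` — it exists, for otherwise the
   arc `γ(x) = y₀ + S·(x, φ(x))` is deep to order `D` (`P` is invertible); `d ≥ 1` since `B_a` has no
   constant term;
4. `corankOne_eliminantMembership` + `corankOne_eliminantLeadingForm` (with `F₀ ↔ F₁` swapped if
   `f_{0,d}(0) = 0`): `D ∈ (F₀, F₁) ∩ ℂ⟦W⟧` with `D(0) = 0` and a nonzero `W_b^d`-coefficient;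
5. `crossCap_evaluation` — `D_{<G}(T̂) ≡ 0 (mod t^G)`; transfer `ψ(W) := D_{<G}(P W)` and
   `lowDegreeVanishing_deg` at degree `d` ((P1) at length `2d ≤ 2D`, (P2) with factor `d ≤ D`): all
   coefficients of `ψ` of degree `≤ d` vanish, hence (undoing `P`) those of `D_{<G}` — contradiction.
-/

-- layout Summits/ValiantsHypothesis/ValiantsHypothesis forces the duplicated namespace component
set_option linter.dupNamespace false

noncomputable section

namespace Summit.ValiantsHypothesis.ValiantsHypothesis.Theorems.BinomialCandidateStubs

open scoped BigOperators
open MvPolynomial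

namespace ShallowCorankOne

/-- The constant coefficient of `H(γ)` for polynomials `γ_l` with zero constant terms is the
constant coefficient of `H`. -/
theorem coeff_zero_aeval {n : ℕ} (γ : Fin n → Polynomial ℂ) (hγ : ∀ l, (γ l).coeff 0 = 0)
    (H : MvPolynomial (Fin n) ℂ) :
    (MvPolynomial.aeval γ H).coeff 0 = MvPolynomial.coeff 0 H := by
  classical
  induction H using MvPolynomial.induction_on with
  | C a => simp
  | add p q hp hq => rw [map_add, Polynomial.coeff_add, coeff_add, hp, hq]
  | mul_X p l hp =>
    rw [map_mul, aeval_X, Polynomial.mul_coeff_zero, hγ l, mul_zero, coeff_mul_X', if_neg]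
    simp

/-- Change of target coordinates and back: `Σ_{i''} C (P' i i'') * Σ_{i'} C (P i'' i') * u i' = u i`
when `P' * P = 1`. -/
theorem sum_C_mul_sum_C_mul {k : ℕ} {σ : Type*}
    (P P' : Matrix (Fin k) (Fin k) ℂ) (hP'P : P' * P = 1) (u : Fin k → MvPolynomial σ ℂ) (i : Fin k) :
    ∑ i'', C (P' i i'') * ∑ i', C (P i'' i') * u i' = u i := by
  classical
  have key : ∀ i', ∑ i'', C (P' i i'') * C (P i'' i') = (C (if i = i' then 1 else 0) : MvPolynomial σ ℂ) := by
    intro i'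
    have h := congr_fun (congr_fun hP'P i) i'
    rw [Matrix.mul_apply, Matrix.one_apply] at h
    rw [← h, map_sum]
    exact Finset.sum_congr rfl fun i'' _ => by rw [← map_mul]
  calc ∑ i'', C (P' i i'') * ∑ i', C (P i'' i') * u i'
      = ∑ i', (∑ i'', C (P' i i'') * C (P i'' i')) * u i' := by
        simp only [Finset.mul_sum, Finset.sum_mul, ← mul_assoc]
        rw [Finset.sum_comm]
    _ = u i := by
        simp_rw [key]
        rw [Finset.sum_eq_single i]
        · simp
        · intro i' _ hi'
          rw [if_neg (Ne.symm hi'), C_0, zero_mul]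
        · intro h; exact absurd (Finset.mem_univ i) h

end ShallowCorankOne

open CrossCap JetReduction ShallowCorankOne in
/-- **Stub `stub_shallowCorankOne`** of line `registered` (skeleton v5) of the crux
`BinomialElusive.BinomialCandidate`: a corank-one integral base point that is not deep to order
`D` is impossible for exponent data with (P1) no relation of length `≤ 2D` and (P2) a congruence
modulus with factor `D`. -/
theorem stub_shallowCorankOne :
    ∀ m ≥ 2, ∀ (D : ℕ) (a b : Fin m → ℕ) (Γ : Fin m → MvPolynomial (Fin (m - 1)) ℂ) (N : ℕ)
      (p : Fin (m - 1) → LaurentSeries ℂ), (∀ i, (Γ i).totalDegree ≤ 2) → 0 < N →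
      (∀ j, 0 ≤ (p j).order) →
      (∀ i, 1 ≤ a i ∧ 1 ≤ b i) → 2 ≤ D →
      (∀ u v : Fin m → ℤ, ∑ i, (|u i| + |v i|) ≤ 2 * (D : ℤ) →
        ∑ i, (u i * (a i : ℤ) + v i * (b i : ℤ)) = 0 → (u, v) = 0) →
      (∃ M' : ℕ, (∀ i, a i % M' = 1 ∧ b i % M' = 1) ∧
        (∀ i j, D * a i < M' * a j ∧ D * a i < M' * b j ∧ D * b i < M' * a j ∧ D * b i < M' * b j)) →
      ∀ κ : Fin (m - 1) → ℂ, κ ≠ 0 →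
        (∀ i, ∑ j, κ j * MvPolynomial.eval (fun l => (p l).coeff 0) (MvPolynomial.pderiv j (Γ i)) = 0) →
        (∀ κ' : Fin (m - 1) → ℂ,
          (∀ i, ∑ j, κ' j * MvPolynomial.eval (fun l => (p l).coeff 0) (MvPolynomial.pderiv j (Γ i)) = 0) →
          ∃ μ : ℂ, κ' = μ • κ) →
        (¬ ∃ γ : Fin (m - 1) → Polynomial ℂ, (∀ j, (γ j).coeff 0 = (p j).coeff 0) ∧ (∀ j, (γ j).coeff 1 = κ j) ∧
          ∀ i, ∀ n ≤ D, (MvPolynomial.aeval γ (Γ i)).coeff n = 0) →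
        (∀ i, MvPolynomial.aeval p (Γ i) =
          HahnSeries.single ((N * a i : ℕ) : ℤ) (1 : ℂ) + HahnSeries.single ((N * b i : ℕ) : ℤ) (1 : ℂ)) →
        False := by
  intro m hm D a b Γ N p hΓ hN hp hab _hD hP1 hP2 κ hκ hker hcorank hshallow hsol
  obtain ⟨n₀, rfl⟩ : ∃ n₀, m = n₀ + 2 := ⟨m - 2, by omega⟩
  classical
  -- the binomials and the precision
  set T : Fin (n₀ + 2) → LaurentSeries ℂ := fun i =>
    HahnSeries.single ((N * a i : ℕ) : ℤ) (1 : ℂ) + HahnSeries.single ((N * b i : ℕ) : ℤ) (1 : ℂ) with hTdef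
  have hT : ∀ i, ∀ g : ℤ, g < 1 → (T i).coeff g = 0 := fun i =>
    vanish_binomial (hab i).1 (hab i).2 hN
  set G : ℕ := 2 * D * N * ∑ i, (a i + b i) + 1 with hGdef
  have hGbound : ∀ i, (D : ℤ) * ((N * a i : ℕ) : ℤ) < G ∧ (D : ℤ) * ((N * b i : ℕ) : ℤ) < G := by
    intro i
    have hi : a i + b i ≤ ∑ i, (a i + b i) :=
      Finset.single_le_sum (f := fun i => a i + b i) (fun _ _ => Nat.zero_le _) (Finset.mem_univ i)
    have key : ∀ c, c ≤ ∑ i, (a i + b i) → D * (N * c) < G := by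
      intro c hc
      rw [hGdef]
      calc D * (N * c) ≤ D * (N * ∑ i, (a i + b i)) := Nat.mul_le_mul_left _ (Nat.mul_le_mul_left _ hc)
        _ ≤ 2 * D * N * ∑ i, (a i + b i) := by
            rw [show 2 * D * N * ∑ i, (a i + b i) = 2 * (D * (N * ∑ i, (a i + b i))) by ring]; omega
        _ < _ := Nat.lt_succ_self _
    exact ⟨by exact_mod_cast key _ (le_trans (Nat.le_add_right _ _) hi),
      by exact_mod_cast key _ (le_trans (Nat.le_add_left _ _) hi)⟩
  have hDG : D < G := by
    have := (hGbound 0).1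
    have h1 : (1 : ℤ) ≤ ((N * a 0 : ℕ) : ℤ) := by exact_mod_cast Nat.mul_pos hN (hab 0).1
    have h2 : (D : ℤ) ≤ (D : ℤ) * ((N * a 0 : ℕ) : ℤ) := by nlinarith
    omega
  -- 1. normal form
  obtain ⟨P, P', S, S', B, q, hPP', hP'P, _hSS', _hS'S, hS0, hB, hq, _hpq, hNFreg, hNF0, hNF1, hreg, h0, h1⟩ :=
    corankOne_normalForm n₀ Γ p T κ hΓ hp hT hsol hκ hker hcorank
  set y₀ : Fin (n₀ + 1) → ℂ := fun l => (p l).coeff 0 with hy₀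
  set aff : Fin (n₀ + 1) → MvPolynomial (Fin (n₀ + 1)) ℂ :=
    fun j => C (y₀ j) + ∑ l, C (S j l) * X l with haff
  set Th : Fin (n₀ + 2) → LaurentSeries ℂ := fun i => ∑ i', algebraMap ℂ (LaurentSeries ℂ) (P i i') * T i'
    with hThdef
  have hTh : ∀ i, ∀ g : ℤ, g < 1 → (Th i).coeff g = 0 := fun i =>
    vanish_sum _ _ fun i' _ => by simpa using vanish_mul (vanish_algebraMap (P i i')) (hT i')
  -- 2. elimination of the regular coordinates, kernel-curve jet to order `D`
  obtain ⟨F₀, F₁, φ, hev0, hev1, l00, l01, l10, l11, hφ01, hφker, hc0, hc1⟩ :=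
    corankOne_iteration n₀ G D B q Th hB hq hTh hreg h0 h1
  set ax : Fin (n₀ + 1) → Polynomial ℂ := Fin.cons Polynomial.X φ with hax
  have hax0 : ∀ l, (ax l).coeff 0 = 0 :=
    Fin.cases (by simp [hax]) (fun j' => by simpa [hax] using (hφ01 j').1)
  -- 3. the depth exists: some `j ≤ D` with `(f_{0,j}(0), f_{1,j}(0)) ≠ 0`
  have hex : ∃ j, j ≤ D ∧ (MvPolynomial.constantCoeff (F₀.coeff j) ≠ 0 ∨
      MvPolynomial.constantCoeff (F₁.coeff j) ≠ 0) := by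
    by_contra hnone
    push Not at hnone
    apply hshallow
    refine ⟨fun j => MvPolynomial.aeval ax (aff j), fun j => ?_, fun j => ?_, fun i n hn => ?_⟩
    · rw [coeff_zero_aeval ax hax0]
      simp [haff, coeff_sum, coeff_C_mul, hy₀]
    · simp only [haff, map_add, aeval_C, Polynomial.algebraMap_eq, map_sum, map_mul, aeval_X,
        Polynomial.coeff_add, Polynomial.coeff_C, one_ne_zero, if_false, zero_add,
        Polynomial.finsetSum_coeff, Polynomial.coeff_C_mul]
      rw [Fin.sum_univ_succ]
      simp only [hax, Fin.cons_zero, Fin.cons_succ, Polynomial.coeff_X_one, mul_one, (hφ01 _).2,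
        mul_zero, Finset.sum_const_zero, add_zero]
      exact hS0 j
    · -- `Γ_i(γ) = (Σ_{i''} P'_{i i''} R_{i''})(ax)` with `R_{i''} = [Y] + B_{i''}`, all `≡ 0 (mod x^{D+1})`
      set R : Fin (n₀ + 2) → MvPolynomial (Fin (n₀ + 1)) ℂ :=
        fun i'' => ∑ i', C (P i'' i') * aeval aff (Γ i') with hR
      have hRax : ∀ i'', (MvPolynomial.aeval ax (R i'')).coeff n = 0 := by
        intro i''
        refine Fin.cases ?_ (fun i₁ => Fin.cases ?_ (fun j' => ?_) i₁) i''
        · rw [show R 0 = B 0 from hNF0, ← hc0 n hn]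
          exact (hnone n hn).1
        · rw [Fin.succ_zero_eq_one, show R 1 = B 1 from hNF1, ← hc1 n hn]
          exact (hnone n hn).2
        · rw [show R j'.succ.succ = X j'.succ + B j'.succ.succ from hNFreg j', map_add, aeval_X]
          simpa [hax] using hφker j' n hn
      have hΓt : aeval aff (Γ i) = ∑ i'', C (P' i i'') * R i'' :=
        (sum_C_mul_sum_C_mul P P' hP'P (fun i' => aeval aff (Γ i')) i).symm
      have hcomp : MvPolynomial.aeval (fun j => MvPolynomial.aeval ax (aff j)) (Γ i) =
          MvPolynomial.aeval ax (MvPolynomial.aeval aff (Γ i)) := (aeval_aeval ax aff (Γ i)).symm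
      have goal' : (MvPolynomial.aeval ax (MvPolynomial.aeval aff (Γ i))).coeff n = 0 := by
        rw [hΓt, map_sum, Polynomial.finsetSum_coeff]
        refine Finset.sum_eq_zero fun i'' _ => ?_
        rw [map_mul, aeval_C, Polynomial.algebraMap_eq, Polynomial.coeff_C_mul, hRax i'', mul_zero]
      exact (congrArg (fun Pp : Polynomial ℂ => Pp.coeff n) hcomp).trans goal'
  -- the depth `d`
  obtain ⟨j₀, hj₀D, hj₀⟩ := hex
  let Q : ℕ → Prop := fun j => MvPolynomial.constantCoeff (F₀.coeff j) ≠ 0 ∨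
    MvPolynomial.constantCoeff (F₁.coeff j) ≠ 0
  have hQex : ∃ j, Q j := ⟨j₀, hj₀⟩
  set d : ℕ := Nat.find hQex with hddef
  have hdspec : Q d := Nat.find_spec hQex
  have hdD : d ≤ D := (Nat.find_min' hQex hj₀).trans hj₀D
  have hdmin : ∀ j < d, MvPolynomial.constantCoeff (F₀.coeff j) = 0 ∧
      MvPolynomial.constantCoeff (F₁.coeff j) = 0 := by
    intro j hj
    have := Nat.find_min hQex (hddef ▸ hj)
    simp only [Q, not_or, not_not] at this
    exact this
  have hd1 : 1 ≤ d := by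
    by_contra hd0
    have hd0' : d = 0 := by omega
    have hB0 : ∀ a' : Fin (n₀ + 2), (MvPolynomial.aeval ax (B a')).coeff 0 = 0 := fun a' => by
      rw [coeff_zero_aeval ax hax0]
      exact hB a' 0 (by simp)
    rcases hdspec with h | h
    · exact h (by rw [hd0', hc0 0 (Nat.zero_le _)]; exact hB0 0)
    · exact h (by rw [hd0', hc1 0 (Nat.zero_le _)]; exact hB0 1)
  -- (P1) at length `2d`, (P2) with factor `d`, precision at level `d`
  have hP1d : ∀ u v : Fin (n₀ + 2) → ℤ, ∑ i, (|u i| + |v i|) ≤ 2 * (d : ℤ) →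
      ∑ i, (u i * (a i : ℤ) + v i * (b i : ℤ)) = 0 → (u, v) = 0 :=
    fun u v hlen hrel => hP1 u v (hlen.trans (by exact_mod_cast Nat.mul_le_mul_left 2 hdD)) hrel
  have hP2d : ∃ M' : ℕ, (∀ i, a i % M' = 1 ∧ b i % M' = 1) ∧
      (∀ i j, d * a i < M' * a j ∧ d * a i < M' * b j ∧ d * b i < M' * a j ∧ d * b i < M' * b j) := by
    obtain ⟨M', hmod, hlt⟩ := hP2
    refine ⟨M', hmod, fun i j => ⟨?_, ?_, ?_, ?_⟩⟩
    · exact lt_of_le_of_lt (Nat.mul_le_mul_right _ hdD) (hlt i j).1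
    · exact lt_of_le_of_lt (Nat.mul_le_mul_right _ hdD) (hlt i j).2.1
    · exact lt_of_le_of_lt (Nat.mul_le_mul_right _ hdD) (hlt i j).2.2.1
    · exact lt_of_le_of_lt (Nat.mul_le_mul_right _ hdD) (hlt i j).2.2.2
  have hGd : ∀ i, (d : ℤ) * ((N * a i : ℕ) : ℤ) < G ∧ (d : ℤ) * ((N * b i : ℕ) : ℤ) < G := by
    intro i
    have hdD' : (d : ℤ) ≤ D := by exact_mod_cast hdD
    have h1 : (0 : ℤ) ≤ ((N * a i : ℕ) : ℤ) := by positivity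
    have h2 : (0 : ℤ) ≤ ((N * b i : ℕ) : ℤ) := by positivity
    exact ⟨lt_of_le_of_lt (mul_le_mul_of_nonneg_right hdD' h1) (hGbound i).1,
      lt_of_le_of_lt (mul_le_mul_of_nonneg_right hdD' h2) (hGbound i).2⟩
  -- 4.–6. eliminant, evaluation, uniqueness: abstract over which of `F₀, F₁` is the divisor
  have main : ∀ (Fa Fb : Polynomial (MvPolynomial (Fin (n₀ + 2)) ℂ)) (ib : Fin (n₀ + 2)),
      (∀ g : ℤ, g < G → (Polynomial.eval₂ (MvPolynomial.aeval Th).toRingHom (q 0) Fa).coeff g = 0) →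
      (∀ g : ℤ, g < G → (Polynomial.eval₂ (MvPolynomial.aeval Th).toRingHom (q 0) Fb).coeff g = 0) →
      (∀ j < d, MvPolynomial.constantCoeff (Fa.coeff j) = 0) →
      (∀ j < d, MvPolynomial.constantCoeff (Fb.coeff j) = 0) →
      MvPolynomial.constantCoeff (Fa.coeff d) ≠ 0 →
      MvPolynomial.coeff (Finsupp.single ib 1) (Fb.coeff 0) = -1 →
      MvPolynomial.coeff (Finsupp.single ib 1) (Fa.coeff 0) = 0 → False := by
    intro Fa Fb ib heva hevb hja hjb hca hlb hla
    set Fa' : PowerSeries (MvPowerSeries (Fin (n₀ + 2)) ℂ) :=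
      ((Fa.map MvPolynomial.coeToMvPowerSeries.ringHom : Polynomial (MvPowerSeries (Fin (n₀ + 2)) ℂ)) :
        PowerSeries (MvPowerSeries (Fin (n₀ + 2)) ℂ)) with hFa'
    set Fb' : PowerSeries (MvPowerSeries (Fin (n₀ + 2)) ℂ) :=
      ((Fb.map MvPolynomial.coeToMvPowerSeries.ringHom : Polynomial (MvPowerSeries (Fin (n₀ + 2)) ℂ)) :
        PowerSeries (MvPowerSeries (Fin (n₀ + 2)) ℂ)) with hFb'
    have hja' : ∀ j < d, MvPowerSeries.constantCoeff (PowerSeries.coeff j Fa') = 0 := fun j hj => by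
      rw [hFa', constantCoeff_coePoly]; exact hja j hj
    have hjb' : ∀ j < d, MvPowerSeries.constantCoeff (PowerSeries.coeff j Fb') = 0 := fun j hj => by
      rw [hFb', constantCoeff_coePoly]; exact hjb j hj
    have hca' : MvPowerSeries.constantCoeff (PowerSeries.coeff d Fa') ≠ 0 := by
      rw [hFa', constantCoeff_coePoly]; exact hca
    obtain ⟨M, Qd, U, V, hdiv, hUV⟩ := corankOne_eliminantMembership (n₀ + 2) d Fa' Fb' hd1 hja' hca'
    obtain ⟨hdet0, hlead⟩ :=
      corankOne_eliminantLeadingForm (n₀ + 2) d Fa' Fb' M Qd ib hd1 hja' hca' hjb' hdiv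
    have hDi : MvPowerSeries.coeff (Finsupp.single ib d) M.det ≠ 0 := by
      intro hzero
      rw [hzero, zero_mul, hFa', hFb', coeff_single_coePoly, coeff_single_coePoly, hlb, hla, mul_zero,
        sub_zero, mul_neg_one] at hlead
      exact pow_ne_zero d (neg_ne_zero.mpr hca') hlead.symm
    have hDev := crossCap_evaluation (n₀ + 2) G Fa Fb M.det U V Th (q 0) hUV hTh (hq 0) heva hevb
    -- transfer to the binomials
    set D' : MvPolynomial (Fin (n₀ + 2)) ℂ := MvPowerSeries.truncTotal G M.det with hD'def
    set ψ : MvPolynomial (Fin (n₀ + 2)) ℂ := aeval (fun i => ∑ i', C (P i i') * X i') D' with hψdef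
    have hψT : aeval T ψ = aeval Th D' := by
      have hfun : (fun i => aeval T (∑ i', C (P i i') * X i')) = Th := by
        funext i; rw [aeval_linear]
      rw [hψdef, aeval_aeval, hfun]
    have hD'1 : ∀ e : Fin (n₀ + 2) →₀ ℕ, e.degree < 1 → coeff e D' = 0 := by
      intro e he
      have he0 : e = 0 := (Finsupp.degree_eq_zero_iff e).mp (by omega)
      rw [he0, hD'def, MvPowerSeries.coeff_truncTotal _ (by simp; omega),
        MvPowerSeries.coeff_zero_eq_constantCoeff_apply, hdet0]
    have lin_mem : ∀ (M₁ : Matrix (Fin (n₀ + 2)) (Fin (n₀ + 2)) ℂ) (i : Fin (n₀ + 2)),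
        ∀ e : Fin (n₀ + 2) →₀ ℕ, e.degree < 1 → coeff e (∑ i', C (M₁ i i') * X i') = 0 := fun M₁ i =>
      degGE_sum _ fun l _ => degGE_C_mul _ (degGE_X l)
    have hψcc : MvPolynomial.constantCoeff ψ = 0 := by
      rw [MvPolynomial.constantCoeff_eq]
      exact aeval_degGE hD'1 (lin_mem P) 0 (by simp)
    have hlow := lowDegreeVanishing_deg (n₀ + 2) d a b N hN hd1 hP1d hP2d ψ G hψcc hGd
      (fun g hg => by rw [hψT]; exact hDev g hg)
    have hψd : ∀ e : Fin (n₀ + 2) →₀ ℕ, e.degree < d + 1 → coeff e ψ = 0 := by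
      intro e he
      refine hlow e ?_
      have : (e.sum fun _ n => n) = e.degree := by rw [Finsupp.degree_apply]; rfl
      omega
    -- undo `P`
    have hback : aeval (fun i => ∑ l, C (P' i l) * X l) ψ = D' := by
      rw [hψdef, aeval_aeval]
      have : (fun i => aeval (fun i => ∑ l, C (P' i l) * X l) (∑ i', C (P i i') * X i')) =
          fun i => (X i : MvPolynomial (Fin (n₀ + 2)) ℂ) := by
        funext i
        rw [aeval_linear, MvPolynomial.algebraMap_eq, sum_C_mul_linear]
        exact linear_eq_X_of_mul_eq_one hPP' i
      rw [this, aeval_X_left, AlgHom.id_apply]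
    have hD'd : ∀ e : Fin (n₀ + 2) →₀ ℕ, e.degree < d + 1 → coeff e D' = 0 := by
      rw [← hback]
      exact aeval_degGE hψd (lin_mem P')
    have := hD'd (Finsupp.single ib d) (by simp)
    rw [hD'def, MvPowerSeries.coeff_truncTotal _ (by simp; omega)] at this
    exact hDi this
  -- dispatch on which depth coefficient is nonzero
  by_cases hF0 : MvPolynomial.constantCoeff (F₀.coeff d) ≠ 0
  · exact main F₀ F₁ 1 hev0 hev1 (fun j hj => (hdmin j hj).1) (fun j hj => (hdmin j hj).2) hF0 l11 l01
  · have hF1 : MvPolynomial.constantCoeff (F₁.coeff d) ≠ 0 := hdspec.resolve_left hF0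
    exact main F₁ F₀ 0 hev1 hev0 (fun j hj => (hdmin j hj).2) (fun j hj => (hdmin j hj).1) hF1 l00 l10

end Summit.ValiantsHypothesis.ValiantsHypothesis.Theorems.BinomialCandidateStubs

end
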